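import Summits.AtomisticToContinuum.BoseEinsteinCondensation.Theorems.BECConjugateDominationPositiveMinimiserRegularity
import Summits.AtomisticToContinuum.BoseEinsteinCondensation.Theorems.BECConjugateDominationHardCoreExtensionDuhamelSmoothing
import Literature.MathematicalPhysics.QuantumManyBody.PeriodicGroundStateFeynmanKacProofs
import Mathlib.MeasureTheory.Integral.IntervalIntegral.FundThmCalculus
import HarnessLib

/-!
# Crux `HardCoreExtension` (stmt-AtomisticToContinuum-11786), line `third-law-current-floor`:
# stub S6r-B2 `stub_duhamelIdentityFK` — the Duhamel identity of the torus Feynman–Kac ground state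
# for a BOUNDED MEASURABLE interaction

For `N ≥ 1`, `L > 0`, a measurable pair potential `v` with bounded periodisation `v^per ≤ C`
(so that the real interaction `W = (∑_{i<j} v^per(xᵢ - xⱼ)).toReal` is bounded and measurable, but
possibly DIScontinuous) and a witness `Ψ₀` of `IsPeriodicGroundStateFK v L Ψ₀`, we prove

  `duhamel 1 ((W - E₀)Ψ₀) X = ∫₀¹ P_s((W - E₀)Ψ₀)(X) ds = P_1Ψ₀(X) - Ψ₀(X)`   for every `X`,

`P_s = heatOp s` the free heat operator and `E₀ = (periodicGroundStateEnergy v N L).toReal`,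
CONDITIONALLY on the smoothed generator limit (the neighbouring stub S6r-B1, taken verbatim as the
hypothesis of the registered signature):
`P_s[h⁻¹(P_hΨ₀ - e^{-hH}Ψ₀)](X) → P_s(WΨ₀)(X)` as `h → 0⁺`, for every `s > 0`.

The argument is the tree's `duhamel_eq_of_eigen` (`…PositiveMinimiserRegularity`, Lipschitz `W`)
with the uniform small-time expansion replaced by the hypothesis:
* `Ψ₀` is THE Feynman–Kac ground state (`IsPeriodicGroundStateFK.unique` against the continuous
  positive witness of `PeriodicGroundStateFeynmanKac_holds`), hence continuous, periodic, bounded;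
* the pointwise eigen-relation `e^{-hH}Ψ₀ = e^{-E₀h}Ψ₀` (`IsPeriodicGroundStateFK.eigen` read
  through `pfkReal_eq_toReal_periodicFKSemigroup`) turns the hypothesis into
  `P_s[h⁻¹(P_hΨ₀ - e^{-E₀h}Ψ₀)](X) → P_s(WΨ₀)(X)`;
* for `s > 0` the free semigroup law `P_{s+h} = P_s P_h` (`heatOp_add_time`) and linearity give
  `h⁻¹(P_{s+h}Ψ₀ - P_sΨ₀)(X) = P_s[h⁻¹(P_hΨ₀ - e^{-E₀h}Ψ₀)](X) + h⁻¹(e^{-E₀h} - 1) P_sΨ₀(X)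
   → P_s(WΨ₀)(X) - E₀ P_sΨ₀(X) = P_s((W - E₀)Ψ₀)(X)`, a RIGHT derivative on `(0, 1)`
  (`DuhamelIdentityFK.hasDerivWithinAt_heatOpR_of_gen`);
* `s ↦ P_sΨ₀(X)` is continuous (`continuous_heatOpR`), and `s ↦ P_s((W - E₀)Ψ₀)(X)` is bounded
  and measurable, hence interval integrable (`DuhamelSmoothing.intervalIntegrable_heatOpR` of the
  sibling file `…HardCoreExtensionDuhamelSmoothing`: joint measurability of the displacement in
  time and sample, Fubini);
* the FTC for right derivatives (`intervalIntegral.integral_eq_sub_of_hasDeriv_right_of_le`).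

All steps are standard facts about the Gaussian semigroup [folklore].
-/

noncomputable section

namespace Summit.AtomisticToContinuum.BoseEinsteinCondensation.Cruxes.HardCoreExtension.ThirdLawCurrentFloor

open MeasureTheory Filter Set Metric intervalIntegral
open scoped ENNReal NNReal Topology
open Literature.MathematicalPhysics.QuantumManyBody.BoseGas
open Summit.AtomisticToContinuum.BoseEinsteinCondensation.Theorems.PositiveMinimiser

namespace DuhamelIdentityFK

variable {N : ℕ}

/-! ### Linearity of the free heat operator, integrable samples, the exponential factor -/

/-- Constants come out of the free heat operator: `P_t (c f) = c P_t f`. [folklore] -/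
theorem heatOp_const_mul (t : ℝ≥0) (c : ℝ) (f : Config N → ℝ) (X : Config N) :
    heatOp t (fun Y => c * f Y) X = c * heatOp t f X :=
  MeasureTheory.integral_const_mul c _

/-- `P_t (f - g) = P_t f - P_t g` when both samples are integrable. [folklore] -/
theorem heatOp_sub (t : ℝ≥0) {f g : Config N → ℝ} (X : Config N)
    (hf : Integrable (fun ω : PathSpace N => f (X + displacement t ω)) (wienerPaths N))
    (hg : Integrable (fun ω : PathSpace N => g (X + displacement t ω)) (wienerPaths N)) :
    heatOp t (fun Y => f Y - g Y) X = heatOp t f X - heatOp t g X :=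
  MeasureTheory.integral_sub hf hg

/-- The sample `ω ↦ f (X + √2 b_t(ω))` of a bounded measurable `f` is integrable. [folklore] -/
theorem integrable_comp_add_displacement_of_measurable {f : Config N → ℝ} (hf : Measurable f)
    {M : ℝ} (hM : ∀ Y, ‖f Y‖ ≤ M) (X : Config N) (t : ℝ≥0) :
    Integrable (fun ω : PathSpace N => f (X + displacement t ω)) (wienerPaths N) :=
  Integrable.of_bound (hf.comp (measurable_add_displacement X t)).aestronglyMeasurable M
    (Eventually.of_forall fun _ => hM _)

/-- `h⁻¹ (e^{-λh} - 1) → -λ` as `h → 0⁺` (the derivative of `h ↦ e^{-λh}` at `0`). [folklore] -/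
theorem tendsto_inv_mul_exp_sub_one (lam : ℝ) :
    Tendsto (fun h : ℝ => h⁻¹ * (Real.exp (-(lam * h)) - 1)) (𝓝[>] 0) (𝓝 (-lam)) := by
  have hd : HasDerivAt (fun h : ℝ => Real.exp (-(lam * h))) (-lam) 0 := by
    have h1 := ((hasDerivAt_id' (0 : ℝ)).const_mul lam).fun_neg.exp
    simp only [mul_zero, neg_zero, Real.exp_zero, mul_one, one_mul] at h1
    exact h1
  have h2 := hd.tendsto_slope_zero_right
  simp only [zero_add, mul_zero, neg_zero, Real.exp_zero, smul_eq_mul] at h2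
  exact h2

/-! ### The right derivative of the free flow and the Duhamel identity -/

/-- **Right derivative of the free flow of `Ψ₀`** from the smoothed difference quotients: if
`P_s[h⁻¹(P_hΨ₀ - e^{-λh}Ψ₀)](X) → P_s(WΨ₀)(X)` as `h → 0⁺` for every `s > 0` (continuous periodic
`Ψ₀`, bounded measurable `W`), then for every real `s > 0`,
`d⁺/ds P_sΨ₀(X) = P_s((W - λ)Ψ₀)(X)` (free semigroup law and linearity). [folklore] -/
theorem hasDerivWithinAt_heatOpR_of_gen {L : ℝ} (hL : 0 < L) {Ψ₀ : Config N → ℝ}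
    (hcont : Continuous Ψ₀)
    (hper : ∀ (X : Config N) (i : Fin N) (k : Fin 3),
      Ψ₀ (X + Pi.single i (EuclideanSpace.single k L)) = Ψ₀ X)
    {W : Config N → ℝ} (hWm : Measurable W) {CW : ℝ} (hWb : ∀ Y, |W Y| ≤ CW) {lam : ℝ}
    (hgen : ∀ s : ℝ≥0, s ≠ 0 → ∀ X : Config N,
      Tendsto (fun h : ℝ =>
        heatOp s (fun Y => h⁻¹ * (heatOpR h Ψ₀ Y - Real.exp (-(lam * h)) * Ψ₀ Y)) X)
        (𝓝[>] 0) (𝓝 (heatOp s (fun Y => W Y * Ψ₀ Y) X)))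
    {s : ℝ} (hs : 0 < s) (X : Config N) :
    HasDerivWithinAt (fun r : ℝ => heatOpR r Ψ₀ X)
      (heatOpR s (fun Y => (W Y - lam) * Ψ₀ Y) X) (Ioi s) s := by
  obtain ⟨M, -, hM⟩ := exists_bound_of_continuous_periodic hL hcont hper
  have hMn : ∀ Y, ‖Ψ₀ Y‖ ≤ M := fun Y => by rw [Real.norm_eq_abs]; exact hM Y
  set s' : ℝ≥0 := s.toNNReal with hs'def
  have hs' : s' ≠ 0 := (Real.toNNReal_pos.2 hs).ne'
  -- integrable samples under `P_s`
  have iΨ : Integrable (fun ω : PathSpace N => Ψ₀ (X + displacement s' ω)) (wienerPaths N) :=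
    integrable_comp_add_displacement (E := ℝ) hcont hMn X s'
  have hWΨm : Measurable fun Y => W Y * Ψ₀ Y := hWm.mul hcont.measurable
  have hWΨb : ∀ Y, ‖W Y * Ψ₀ Y‖ ≤ CW * M := fun Y => by
    rw [norm_mul, Real.norm_eq_abs, Real.norm_eq_abs]
    exact mul_le_mul (hWb Y) (hM Y) (abs_nonneg _) ((abs_nonneg _).trans (hWb Y))
  have iWΨ : Integrable (fun ω : PathSpace N =>
      W (X + displacement s' ω) * Ψ₀ (X + displacement s' ω)) (wienerPaths N) :=
    integrable_comp_add_displacement_of_measurable hWΨm hWΨb X s'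
  -- the value of the derivative, split by linearity
  have hD : heatOpR s (fun Y => (W Y - lam) * Ψ₀ Y) X =
      heatOp s' (fun Y => W Y * Ψ₀ Y) X + -lam * heatOp s' Ψ₀ X := by
    have hsplit : (fun Y => (W Y - lam) * Ψ₀ Y) = fun Y => W Y * Ψ₀ Y - lam * Ψ₀ Y := by
      funext Y; ring
    rw [heatOpR, ← hs'def, hsplit, heatOp_sub, heatOp_const_mul]
    · ring
    · exact iWΨ
    · exact iΨ.const_mul _
  -- the limit of the two pieces of the difference quotient
  have hG : Tendsto (fun h : ℝ =>
      heatOp s' (fun Y => h⁻¹ * (heatOpR h Ψ₀ Y - Real.exp (-(lam * h)) * Ψ₀ Y)) X +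
        h⁻¹ * (Real.exp (-(lam * h)) - 1) * heatOp s' Ψ₀ X) (𝓝[>] 0)
      (𝓝 (heatOp s' (fun Y => W Y * Ψ₀ Y) X + -lam * heatOp s' Ψ₀ X)) :=
    (hgen s' hs' X).add ((tendsto_inv_mul_exp_sub_one lam).mul_const _)
  -- change of variables `h = r - s`
  have htrans : Tendsto (fun r : ℝ => r - s) (𝓝[>] s) (𝓝[>] 0) := by
    refine tendsto_nhdsWithin_iff.2 ⟨?_, ?_⟩
    · have h1 : Tendsto (fun r : ℝ => r - s) (𝓝 s) (𝓝 (s - s)) :=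
        tendsto_id.sub tendsto_const_nhds
      rw [sub_self] at h1
      exact h1.mono_left nhdsWithin_le_nhds
    · filter_upwards [self_mem_nhdsWithin] with r hr
      exact sub_pos.2 (Set.mem_Ioi.1 hr)
  rw [hasDerivWithinAt_iff_tendsto_slope' Set.self_notMem_Ioi, hD]
  refine (hG.comp htrans).congr' ?_
  filter_upwards [self_mem_nhdsWithin] with r hr
  have hrs : s < r := hr
  simp only [Function.comp_apply, slope_def_field]
  -- name the increment `h = r - s > 0`
  set h : ℝ := r - s with hhdef
  have hh : 0 < h := sub_pos.2 hrs
  have hPc : Continuous (heatOp h.toNNReal Ψ₀) := continuous_heatOp (E := ℝ) hcont hMn _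
  have hPb : ∀ Y, ‖heatOp h.toNNReal Ψ₀ Y‖ ≤ M := fun Y => norm_heatOp_le hMn _ Y
  have iP : Integrable (fun ω : PathSpace N => heatOp h.toNNReal Ψ₀ (X + displacement s' ω))
      (wienerPaths N) :=
    integrable_comp_add_displacement hPc hPb X s'
  -- `P_r = P_s P_h` (free semigroup law on `ℝ≥0`)
  have hsum : s + h = r := by rw [hhdef]; ring
  have hr_split : r.toNNReal = s' + h.toNNReal := by
    rw [hs'def, ← Real.toNNReal_add hs.le hh.le, hsum]
  unfold heatOpR
  rw [hr_split, heatOp_add_time hL hcont hper s' h.toNNReal X, ← hs'def, heatOp_const_mul,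
    heatOp_sub, heatOp_const_mul]
  · ring
  · exact iP
  · exact iΨ.const_mul _

/-- **The Duhamel identity from the smoothed generator.** For `L > 0`, a continuous `Lℤ³`-periodic
`Ψ₀`, a bounded measurable `W` and a real `λ` such that
`P_s[h⁻¹(P_hΨ₀ - e^{-λh}Ψ₀)](X) → P_s(WΨ₀)(X)` (`h → 0⁺`) for every `s > 0` and `X`: for `T ≥ 0`,
`duhamel T ((W - λ)Ψ₀) X = ∫₀ᵀ P_s((W - λ)Ψ₀)(X) ds = heatOpR T Ψ₀ X - Ψ₀ X` (FTC for right
derivatives; the integrand is bounded and measurable in `s`). [folklore] -/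
theorem duhamel_eq_of_gen {L : ℝ} (hL : 0 < L) {Ψ₀ : Config N → ℝ} (hcont : Continuous Ψ₀)
    (hper : ∀ (X : Config N) (i : Fin N) (k : Fin 3),
      Ψ₀ (X + Pi.single i (EuclideanSpace.single k L)) = Ψ₀ X)
    {W : Config N → ℝ} (hWm : Measurable W) {CW : ℝ} (hWb : ∀ Y, |W Y| ≤ CW) {lam : ℝ}
    (hgen : ∀ s : ℝ≥0, s ≠ 0 → ∀ X : Config N,
      Tendsto (fun h : ℝ =>
        heatOp s (fun Y => h⁻¹ * (heatOpR h Ψ₀ Y - Real.exp (-(lam * h)) * Ψ₀ Y)) X)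
        (𝓝[>] 0) (𝓝 (heatOp s (fun Y => W Y * Ψ₀ Y) X)))
    {T : ℝ} (hT : 0 ≤ T) (X : Config N) :
    duhamel T (fun Y => (W Y - lam) * Ψ₀ Y) X = heatOpR T Ψ₀ X - Ψ₀ X := by
  obtain ⟨M, -, hM⟩ := exists_bound_of_continuous_periodic hL hcont hper
  have hMn : ∀ Y, ‖Ψ₀ Y‖ ≤ M := fun Y => by rw [Real.norm_eq_abs]; exact hM Y
  have hCW0 : 0 ≤ CW := (abs_nonneg _).trans (hWb 0)
  set w : Config N → ℝ := fun Y => (W Y - lam) * Ψ₀ Y with hw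
  have hwm : Measurable w := (hWm.sub measurable_const).mul hcont.measurable
  have hwb : ∀ Y, ‖w Y‖ ≤ (CW + |lam|) * M := fun Y => by
    rw [Real.norm_eq_abs, hw]
    simp only
    rw [abs_mul]
    exact mul_le_mul ((abs_sub _ _).trans (add_le_add (hWb Y) le_rfl)) (hM Y) (abs_nonneg _)
      (add_nonneg hCW0 (abs_nonneg _))
  have hφ : Continuous fun r : ℝ => heatOpR r Ψ₀ X := continuous_heatOpR (E := ℝ) hcont hMn X
  have hderiv : ∀ r ∈ Ioo (0 : ℝ) T, HasDerivWithinAt (fun r : ℝ => heatOpR r Ψ₀ X)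
      (heatOpR r w X) (Ioi r) r := fun r hr =>
    hasDerivWithinAt_heatOpR_of_gen hL hcont hper hWm hWb hgen hr.1 X
  have hint : IntervalIntegrable (fun r : ℝ => heatOpR r w X) volume 0 T :=
    DuhamelSmoothing.intervalIntegrable_heatOpR hwm hwb X 0 T
  have hftc := integral_eq_sub_of_hasDeriv_right_of_le hT hφ.continuousOn hderiv hint
  rw [duhamel, hftc, heatOpR_of_nonpos le_rfl]

end DuhamelIdentityFK

/-- **S6r-B2 `stub_duhamelIdentityFK`** (the Duhamel identity of the Feynman–Kac ground state of a
BOUNDED measurable potential, from the smoothed generator S6r-B1 taken as a hypothesis). For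
`N ≥ 1`, `L > 0`, measurable `v` with `v^per ≤ C` and a witness `Ψ₀` of
`IsPeriodicGroundStateFK v L Ψ₀`: `∫₀¹ P_s((W - E₀)Ψ₀)(X) ds = P_1Ψ₀(X) - Ψ₀(X)` for every `X`
(`W = (∑_{i<j} v^per(xᵢ - xⱼ)).toReal`, `E₀ = (periodicGroundStateEnergy v N L).toReal`). Proof:
`Ψ₀` is the continuous positive witness of `PeriodicGroundStateFeynmanKac_holds`
(`IsPeriodicGroundStateFK.unique`); the pointwise eigen-relation `e^{-hH}Ψ₀ = e^{-E₀h}Ψ₀`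
(`IsPeriodicGroundStateFK.eigen` through `pfkReal_eq_toReal_periodicFKSemigroup`) inserted in the
hypothesis; then `DuhamelIdentityFK.duhamel_eq_of_gen` (free semigroup law, right derivative on
`(0, 1)`, FTC for right derivatives) at `T = 1`. [folklore] -/
theorem stub_duhamelIdentityFK :
    (∀ {N : ℕ} (L : ℝ) (v : ℝ → ℝ≥0∞) (C : ℝ≥0), 0 < L → Measurable v →
      (∀ x, periodizedPotential v L x ≤ C) →
      ∀ Ψ₀ : Config N → ℝ, Continuous Ψ₀ →
        (∀ (X : Config N) (i : Fin N) (k : Fin 3),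
          Ψ₀ (X + Pi.single i (EuclideanSpace.single k L)) = Ψ₀ X) →
        ∀ s : ℝ≥0, s ≠ 0 → ∀ X : Config N,
          Tendsto (fun h : ℝ => heatOp s (fun Y => h⁻¹ * (heatOpR h Ψ₀ Y - pfkReal v L h Ψ₀ Y)) X)
            (𝓝[>] 0) (𝓝 (heatOp s (fun Y => (periodicInteraction v L Y).toReal * Ψ₀ Y) X))) →
    ∀ (N : ℕ) (L : ℝ) (v : ℝ → ℝ≥0∞), 1 ≤ N → 0 < L → Measurable v →
      (∃ C : ℝ≥0, ∀ x, periodizedPotential v L x ≤ C) →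
      ∀ Ψ₀ : Config N → ℝ, IsPeriodicGroundStateFK v L Ψ₀ → ∀ X : Config N,
        duhamel 1 (fun Y => ((periodicInteraction v L Y).toReal -
            (periodicGroundStateEnergy v N L).toReal) * Ψ₀ Y) X = heatOp 1 Ψ₀ X - Ψ₀ X := by
  intro hgen N L v hN hL hv hC Ψ₀ hGS X
  obtain ⟨C, hC⟩ := hC
  -- `Ψ₀` is THE Feynman–Kac ground state: continuous (and positive)
  obtain ⟨Φ, hΦ, hcont, -⟩ := PeriodicGroundStateFeynmanKac_holds N L v hN hL hv ⟨C, hC⟩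
  obtain rfl : Ψ₀ = Φ := hGS.unique hΦ
  have hper := hGS.periodic
  -- the pointwise eigen-relation in real form
  have heig : ∀ t : ℝ, 0 < t → ∀ Y : Config N, pfkReal v L t Ψ₀ Y =
      Real.exp (-((periodicGroundStateEnergy v N L).toReal * t)) * Ψ₀ Y := by
    intro t ht Y
    rw [pfkReal_eq_toReal_periodicFKSemigroup hv L t hcont.measurable hGS.nonneg Y,
      hGS.eigen t ht.le Y, ENNReal.toReal_ofReal (mul_nonneg (Real.exp_pos _).le (hGS.nonneg Y))]
  -- the interaction is bounded and measurable
  have hWm : Measurable fun Y : Config N => (periodicInteraction v L Y).toReal :=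
    (measurable_periodicInteraction hv L).ennreal_toReal
  have hWb : ∀ Y : Config N, |(periodicInteraction v L Y).toReal| ≤ ((N * N : ℕ) : ℝ) * C :=
    fun Y => by
    rw [abs_of_nonneg ENNReal.toReal_nonneg]
    exact toReal_periodicInteraction_le hC Y
  -- the smoothed generator, with the eigen-relation inserted
  have hgen' : ∀ s : ℝ≥0, s ≠ 0 → ∀ X : Config N,
      Tendsto (fun h : ℝ => heatOp s (fun Y => h⁻¹ * (heatOpR h Ψ₀ Y -
        Real.exp (-((periodicGroundStateEnergy v N L).toReal * h)) * Ψ₀ Y)) X)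
        (𝓝[>] 0) (𝓝 (heatOp s (fun Y => (periodicInteraction v L Y).toReal * Ψ₀ Y) X)) := by
    intro s hs X
    refine (hgen L v C hL hv hC Ψ₀ hcont hper s hs X).congr' ?_
    filter_upwards [self_mem_nhdsWithin] with h hh
    have hh' : (0 : ℝ) < h := hh
    simp only [heig h hh']
  have h := DuhamelIdentityFK.duhamel_eq_of_gen hL hcont hper hWm hWb hgen' zero_le_one X
  rwa [heatOpR, Real.toNNReal_one] at h

end Summit.AtomisticToContinuum.BoseEinsteinCondensation.Cruxes.HardCoreExtension.ThirdLawCurrentFloor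

end
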